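import Literature.MathematicalPhysics.QuantumFieldTheory.Balaban1983to89.B4Ineq112LpChain
import Literature.MathematicalPhysics.QuantumFieldTheory.Balaban1983to89.B4Ineq19WalkRoute

/-!
# `Balaban1983to89.B4Ineq112LpChainMembers` — [Balaban1983RegularityDecay] THEOREM (1.11)–(1.12): the DERIVATIVE and the
# HÖLDER members of the `δG_k(Ω,Ω₀,A)` clause FOR A GENERAL PAIR `Ω ⊂ Ω₀` UNDER `dist({x,x′}, Ω^c) ≥ R₀`, by the printed
# cancellation through the mixed `L^p` chain (instances of `B4Ineq112LpChain.probe_delta_bound_lp`)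

statement-level skeleton of published theorems with citation tags; proofs where landed; nothing here is a claim about the Yang–Mills mass gap

CITATION HEADER.  T. Bałaban, *Regularity and decay of lattice Green's functions*, Commun. Math. Phys. **89** (1983)
571–597, doi:10.1007/bf01214744 [Balaban1983RegularityDecay] (cell paper B4; held text
`paper:balaban1983-cmp89-regularity-decay`, journal page = PDF page + 570; pp. 572–573, 577–579, 581).  Unit
`lit-balaban-r01` gen 6 (B4 fold owner), HOME `run/shared/lean/pub/lit-balaban/`, SKELETON rows **B4.Thm@573**
((1.11)–(1.12) derivative and Hölder members, general `Ω ⊂ Ω₀`, `R₀`), **B4.Cor2.3** (δG clause).  Theorems only;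
imports `B4Ineq112LpChain` (`probe_delta_bound_lp`) and `B4Ineq19WalkRoute` (probe algebra: `holderOp_mul_mulH`,
`fld_holderOp_mulVec`; through it `B4Ineq110WalkRouteDeriv`: `unitOp_mul_mulH`, `norm_unitOp_le`, `fld_bondOp_mulVec`).

WHAT IS PRINTED.  p. 573: *«If Ω ⊂ Ω₀, then for δG_k(Ω,Ω₀,A) defined by the equality δG_k(Ω,Ω₀,A) = G_k(Ω,A) − G_k(Ω₀,A),
(1.11) we have the inequalities (1.5) and (1.6)»* ⟦= (1.9) and (1.10)⟧ *«(with the same restrictions on x, x′) with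
the additional factor exp(−δ₀dist(x,Ω^c) − δ₀dist(supp f,Ω^c)) (1.12) on the right hand sides.»*; p. 579: *«We estimate
the terms of the representation as above and we get the first inequality in (2.22) with 2^{d+1} instead of 2^d and
with the restriction n ≥ … ≥ (2M)⁻¹(dist({x,x′}, supp f) + dist({x,x′}, Ω^c) + dist(supp f, Ω^c)) − 3. It implies all
the inequalities we need.»*

WHAT THIS MODULE PROVES (all in full; setting of `B4Ineq112LpChain.ineq112_value_lp`, inputs in the printed norms for
both cube families, `R₀` in label form for the cubes seeing the probe's points).
* **`ineq112_deriv_lp`** (+ `_apply`) — probe `P_b = E_{xy}[W(x,y)] − E_{xx}[1]` (`|x−y|_∞ ≤ M/8`), first-letter inputs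
  `‖G_j‖, ‖G_j^Ω‖ ≤ γ` and `‖P_bG_j‖, ‖P_bG_j^Ω‖ ≤ γ′` at good cubes:
  `‖P_b(δG_k(Ω,Ω₀,A)f)‖_∞ ≤ 2^{d+3}e^{35/8}(γ′ + wγ)·V·exp(−(D + D₀ + D₁)/(2M))·‖f‖_∞`.
* **`ineq112_holder_lp`** (+ `_apply`) — Hölder probe `P_H = σ(E_{xy′}[UW(x′,y′)] − E_{xx′}[U] − (E_{xy}[W(x,y)] −
  E_{xx}[1]))` (bonds within `M/8`, any `σ`, `U`), Hölder inputs `‖P_H·h_jG_jh_j‖, ‖P_H·h_jG_j^Ωh_j‖ ≤ γ_H` at good cubes: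
  `‖P_H(δG_k(Ω,Ω₀,A)f)‖_∞ ≤ 2^{d+4}e^{9/2}γ_H·V·exp(−(D + D₀ + D₁)/(2M))·‖f‖_∞`.
With `B4Ineq110LpChain`, `B4Ineq19LpChain`, `B4Ineq112LpChain` ALL SIX displayed members of (1.9)–(1.12) hold for general
regions under the printed `R₀` restriction, modulo the per-cube inputs in the printed norms.
HONEST SCOPE as in those files.  No `def`, no `Prop` fact, no `sorry`; axioms standard.
-/

namespace Literature.MathematicalPhysics.QuantumFieldTheory.Balaban1983to89.B4Ineq112LpChainMembers

open Literature.MathematicalPhysics.QuantumFieldTheory.Balaban1983to89.B4GaugeCovariance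
open Literature.MathematicalPhysics.QuantumFieldTheory.Balaban1983to89.B4Commutators25to211
open Literature.MathematicalPhysics.QuantumFieldTheory.Balaban1983to89.B4PartitionUnity22
open Literature.MathematicalPhysics.QuantumFieldTheory.Balaban1983to89.B4RandomWalk213
open Literature.MathematicalPhysics.QuantumFieldTheory.Balaban1983to89.B4Eq26Locality
open Literature.MathematicalPhysics.QuantumFieldTheory.Balaban1983to89.B4Ineq110WalkRoute
open Literature.MathematicalPhysics.QuantumFieldTheory.Balaban1983to89.B4Ineq110WalkRouteDeriv
open Literature.MathematicalPhysics.QuantumFieldTheory.Balaban1983to89.B4Ineq19WalkRoute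
open Literature.MathematicalPhysics.QuantumFieldTheory.Balaban1983to89.B4Ineq110LpChain
open Literature.MathematicalPhysics.QuantumFieldTheory.Balaban1983to89.B4Ineq112LpChain
open scoped Matrix NNReal
open scoped Matrix.Norms.Operator

section Route

variable {X Y κ : Type*} [Fintype X] [Fintype Y] [Fintype κ] [DecidableEq X] [DecidableEq κ] {d : ℕ}

/-- the labels that can see a site number at most `2^d`. [cite: Balaban1983RegularityDecay, §2 p.575] -/
private theorem card_labelBox_le (M : ℝ) (x : Fin d → ℝ) :
    (Fintype.piFinset fun μ => ({⌊x μ / M⌋, ⌊x μ / M⌋ + 1} : Finset ℤ)).card ≤ 2 ^ d := by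
  rw [Fintype.card_piFinset]
  calc ∏ μ, ({⌊x μ / M⌋, ⌊x μ / M⌋ + 1} : Finset ℤ).card ≤ 2 ^ (Finset.univ : Finset (Fin d)).card :=
        Finset.prod_le_pow_card _ _ 2 fun μ _ => Finset.card_le_two
    _ = 2 ^ d := by rw [Finset.card_univ, Fintype.card_fin]

/-- **[B4] THEOREM (1.11)–(1.12), DERIVATIVE MEMBER, GENERAL PAIR `Ω ⊂ Ω₀`, UNDER THE `R₀` CONDITION — by the mixed
`L^p` chain.**  Instance of `B4Ineq112LpChain.probe_delta_bound_lp` with the bond-difference probe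
`P_b = E_{xy}[W(x,y)] − E_{xx}[1]` (`|x−y|_∞ ≤ M/8`, `w ≥` the row `ℓ¹`-norms of `W(x,y)`): `≤ 2^{d+1}` cubes see `x` or
`y`, all within `(3/4)M` of `x`, and `‖P_b·h_jG_jh_j‖ ≤ γ′ + wγ` for BOTH cube families from the inputs `‖G_j‖ ≤ γ`,
`‖P_bG_j‖ ≤ γ′` at the good cubes.  Conclusion, for `f` supported in `F × κ` with `‖f‖₂ ≤ V‖f‖_∞` and
`D ≤ dist_∞(x,F)`, `D₀ ≤ dist_∞(x,Ω^c)`, `D₁ ≤ dist_∞(F,Ω^c)`: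
`‖P_b((G_k(Ω,A) − G_k(Ω₀,A))f)‖_∞ ≤ 2^{d+3}e^{35/8}(γ′ + wγ)·V·exp(−(D + D₀ + D₁)/(2M))·‖f‖_∞`.
[cite: Balaban1983RegularityDecay, Theorem (1.10)–(1.12) p.573; p.579 after (2.22); Cor. 2.3 p.581] -/
theorem ineq112_deriv_lp {M : ℝ} (hM : 0 < M) (pos : X → Fin d → ℝ) (c : X → X → ℝ) (m2 a : ℝ)
    (q : Y → X → ℝ) (W : X → X → Matrix κ κ ℝ) (T : Y → X → Matrix κ κ ℝ)
    (hc : ∀ x z', c x z' ≠ 0 → ∀ μ, |pos x μ - pos z' μ| ≤ 1 / 8 * M)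
    (hq : ∀ y x z', q y x ≠ 0 → q y z' ≠ 0 → ∀ μ, |pos x μ - pos z' μ| ≤ 1 / 8 * M)
    (s : Finset (Fin d → ℤ)) (hs : ∀ j x, hCube M j (pos x) ≠ 0 → j ∈ s)
    (S : (Fin d → ℤ) → X → Prop) [∀ j, DecidablePred (S j)]
    (hS : ∀ j z, (∀ μ, |pos z μ - M * j μ| ≤ 7 / 8 * M) → S j z)
    (hS1 : ∀ j z, S j z → ∀ μ, |pos z μ - M * j μ| ≤ M)
    (hSq : ∀ j y z z', q y z ≠ 0 → q y z' ≠ 0 → (S j z ↔ S j z'))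
    (W' : (Fin d → ℤ) → X → X → Matrix κ κ ℝ) (T' : (Fin d → ℤ) → Y → X → Matrix κ κ ℝ)
    (hWW' : ∀ j x z', (∀ μ, |pos x μ - M * j μ| ≤ 3 / 4 * M) → (∀ μ, |pos z' μ - M * j μ| ≤ 3 / 4 * M) →
      W' j x z' = W x z')
    (hTT' : ∀ j y x, q y x ≠ 0 → (∀ μ, |pos x μ - M * j μ| ≤ 3 / 4 * M) → T' j y x = T y x)
    (Ω : X → Prop) [DecidablePred Ω]
    (Gj : (Fin d → ℤ) → Matrix (X × κ) (X × κ) ℝ)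
    (hGj : ∀ j ∈ s, covOp (fun z z' => if (S j z ↔ S j z') then c z z' else 0) m2 a q (W' j) (T' j) * Gj j = 1)
    (GjΩ : (Fin d → ℤ) → Matrix (X × κ) (X × κ) ℝ)
    (hGjΩ : ∀ j ∈ s, covOp (fun z z' => if (S j z ↔ S j z') then (if (Ω z ↔ Ω z') then c z z' else 0) else 0)
      m2 a q (W' j) (T' j) * GjΩ j = 1)
    (G : Matrix (X × κ) (X × κ) ℝ) (hGH : G * covOp (fun z z' => if (Ω z ↔ Ω z') then c z z' else 0) m2 a q W T = 1)
    (G' : Matrix (X × κ) (X × κ) ℝ) (hG'H : G' * covOp c m2 a q W T = 1)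
    -- the bond
    (x y : X) (hxy : ∀ μ, |pos x μ - pos y μ| ≤ 1 / 8 * M) {w : ℝ} (hw0 : 0 ≤ w)
    (hw : ∀ k, ∑ k', |W x y k k'| ≤ w)
    -- the interior cubes and the per-cube analytic inputs for both families, in the printed norms
    (good : (Fin d → ℤ) → Prop) {γ γ' β ω : ℝ} {n₀ : ℕ} (hn₀ : 0 < n₀) (hω : 0 < ω) (hγ0 : 0 ≤ γ) (hγ'0 : 0 ≤ γ')
    (hβ0 : 0 ≤ β) (hγ : ∀ i : ↥s, good i.1 → ‖Gj i.1‖ ≤ γ) (hγΩ : ∀ i : ↥s, good i.1 → ‖GjΩ i.1‖ ≤ γ)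
    (hγ' : ∀ i : ↥s, good i.1 → ‖(unitOp x y (W x y) - unitOp x x 1) * Gj i.1‖ ≤ γ')
    (hγ'Ω : ∀ i : ↥s, good i.1 → ‖(unitOp x y (W x y) - unitOp x x 1) * GjΩ i.1‖ ≤ γ')
    (h0 : ∀ i : ↥s, good i.1 → ‖opK (fun z z' => if (S i.1 z ↔ S i.1 z') then c z z' else 0) m2 a q (W' i.1) (T' i.1)
        (fun z => hCube M i.1 (pos z)) * Gj i.1 * mulH (ι := κ) (fun z => hCube M i.1 (pos z))‖ ≤ β)
    (h0Ω : ∀ i : ↥s, good i.1 → ‖opK (fun z z' => if (S i.1 z ↔ S i.1 z') then (if (Ω z ↔ Ω z') then c z z' else 0) else 0)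
        m2 a q (W' i.1) (T' i.1) (fun z => hCube M i.1 (pos z)) * GjΩ i.1
        * mulH (ι := κ) (fun z => hCube M i.1 (pos z))‖ ≤ β)
    (hgr : ∀ i : ↥s, good i.1 → ∀ t : ℕ, 1 ≤ t → t ≤ n₀ → ∀ g : X × κ → ℝ,
      lvl ω n₀ (t - 1) ((opK (fun z z' => if (S i.1 z ↔ S i.1 z') then c z z' else 0) m2 a q (W' i.1) (T' i.1)
        (fun z => hCube M i.1 (pos z)) * Gj i.1 * mulH (ι := κ) (fun z => hCube M i.1 (pos z))) *ᵥ g) ≤ β * lvl ω n₀ t g)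
    (hgrΩ : ∀ i : ↥s, good i.1 → ∀ t : ℕ, 1 ≤ t → t ≤ n₀ → ∀ g : X × κ → ℝ,
      lvl ω n₀ (t - 1) ((opK (fun z z' => if (S i.1 z ↔ S i.1 z') then (if (Ω z ↔ Ω z') then c z z' else 0) else 0)
        m2 a q (W' i.1) (T' i.1) (fun z => hCube M i.1 (pos z)) * GjΩ i.1
        * mulH (ι := κ) (fun z => hCube M i.1 (pos z))) *ᵥ g) ≤ β * lvl ω n₀ t g)
    (h2 : ∀ (i : ↥s) (g : X × κ → ℝ), lpv ω 2 ((opK (fun z z' => if (S i.1 z ↔ S i.1 z') then c z z' else 0) m2 a q (W' i.1) (T' i.1)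
        (fun z => hCube M i.1 (pos z)) * Gj i.1 * mulH (ι := κ) (fun z => hCube M i.1 (pos z))) *ᵥ g) ≤ β * lpv ω 2 g)
    (h2Ω : ∀ (i : ↥s) (g : X × κ → ℝ), lpv ω 2 ((opK (fun z z' => if (S i.1 z ↔ S i.1 z') then (if (Ω z ↔ Ω z') then c z z' else 0) else 0)
        m2 a q (W' i.1) (T' i.1) (fun z => hCube M i.1 (pos z)) * GjΩ i.1
        * mulH (ι := κ) (fun z => hCube M i.1 (pos z))) *ᵥ g) ≤ β * lpv ω 2 g)
    (h3β : (3 : ℝ) ^ d * β ≤ Real.exp (-1))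
    (hR₀ : ∀ i ∈ s, (hCube M i (pos x) ≠ 0 ∨ hCube M i (pos y) ≠ 0) →
      ∀ j ∈ s, (∀ μ, |i μ - j μ| ≤ (n₀ : ℤ)) → good j)
    -- the support set, the three separations, the function
    (F : X → Prop) [DecidablePred F] {D D₀ D₁ : ℝ}
    (hD : ∀ x'', F x'' → ∃ μ, D ≤ |pos x μ - pos x'' μ|)
    (hD₀ : ∀ x₁, ¬ Ω x₁ → ∃ μ, D₀ ≤ |pos x μ - pos x₁ μ|)
    (hD₁ : ∀ x'', F x'' → ∀ x₁, ¬ Ω x₁ → ∃ μ, D₁ ≤ |pos x₁ μ - pos x'' μ|)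
    (f : X × κ → ℝ) (hfF : ∀ p : X × κ, ¬ F p.1 → f p = 0) {V : ℝ} (hV : 1 ≤ V) (hfV : lpv ω 2 f ≤ V * ‖f‖) :
    ‖(unitOp x y (W x y) - unitOp x x 1) *ᵥ ((G - G') *ᵥ f)‖
      ≤ 2 ^ (d + 3) * Real.exp (35 / 8) * (γ' + w * γ) * V * Real.exp (-((D + D₀ + D₁) / (2 * M))) * ‖f‖ := by
  classical
  set h : (Fin d → ℤ) → X → ℝ := fun j z => hCube M j (pos z) with hh
  set Pb : Matrix (X × κ) (X × κ) ℝ := unitOp x y (W x y) - unitOp x x 1 with hPbdef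
  -- sizes
  have hh0 : ∀ j z, 0 ≤ h j z := fun j z => hCube_nonneg M j (pos z)
  have hhle : ∀ j z, h j z ≤ 1 := fun j z => hCube_le_one M j (pos z)
  have hh1 : ∀ j z, |h j z| ≤ 1 := fun j z => abs_le.mpr ⟨by linarith [hh0 j z], hhle j z⟩
  have hnH : ∀ j, ‖mulH (ι := κ) (h j)‖ ≤ 1 := fun j => norm_mulH_le _ zero_le_one (hh1 j)
  have hnUW : ‖unitOp x y (W x y)‖ ≤ w := norm_unitOp_le x y _ hw0 hw
  -- `P_b·h_j = h_j(x)P_b + (h_j(y) − h_j(x))E_{xy}[W]`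
  have hPbH : ∀ j, Pb * mulH (ι := κ) (h j) = h j x • Pb + (h j y - h j x) • unitOp x y (W x y) := by
    intro j
    simp only [hPbdef, Matrix.sub_mul, unitOp_mul_mulH, smul_sub, sub_smul]
    abel
  -- the starting cubes: those seeing `x` or `y`
  set S₀ : Finset ↥s := Finset.univ.filter fun i : ↥s => h i.1 x ≠ 0 ∨ h i.1 y ≠ 0 with hS₀
  have hP0 : ∀ i : ↥s, i ∉ S₀ → Pb * mulH (ι := κ) (h i.1) = 0 := by
    intro i hi
    have hix : h i.1 x = 0 := by
      by_contra hne
      exact hi (Finset.mem_filter.mpr ⟨Finset.mem_univ _, Or.inl hne⟩)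
    have hiy : h i.1 y = 0 := by
      by_contra hne
      exact hi (Finset.mem_filter.mpr ⟨Finset.mem_univ _, Or.inr hne⟩)
    rw [hPbH i.1, hix, hiy, sub_zero, zero_smul, zero_smul, add_zero]
  have hcard : S₀.card ≤ 2 ^ (d + 1) := by
    have hsub : S₀.map (Function.Embedding.subtype (· ∈ s))
        ⊆ (Fintype.piFinset fun μ => ({⌊pos x μ / M⌋, ⌊pos x μ / M⌋ + 1} : Finset ℤ))
          ∪ (Fintype.piFinset fun μ => ({⌊pos y μ / M⌋, ⌊pos y μ / M⌋ + 1} : Finset ℤ)) := by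
      intro j hj
      obtain ⟨i, hi, rfl⟩ := Finset.mem_map.mp hj
      obtain ⟨-, hixy⟩ := Finset.mem_filter.mp hi
      rcases hixy with hix | hiy
      · exact Finset.mem_union_left _ (mem_box_of_hCube_ne_zero hix)
      · exact Finset.mem_union_right _ (mem_box_of_hCube_ne_zero hiy)
    calc S₀.card = (S₀.map (Function.Embedding.subtype (· ∈ s))).card := (Finset.card_map _).symm
      _ ≤ _ := Finset.card_le_card hsub
      _ ≤ _ := Finset.card_union_le _ _
      _ ≤ 2 ^ d + 2 ^ d := add_le_add (card_labelBox_le M (pos x)) (card_labelBox_le M (pos y))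
      _ = 2 ^ (d + 1) := by ring
  have hS₀ρ : ∀ i ∈ S₀, ∀ μ, |pos x μ - M * i.1 μ| < 3 / 4 * M := by
    intro i hi μ
    obtain ⟨-, hixy⟩ := Finset.mem_filter.mp hi
    rcases hixy with hix | hiy
    · exact (hCube_ne_zero_imp hM hix μ).trans (by nlinarith)
    · calc |pos x μ - M * i.1 μ| = |(pos x μ - pos y μ) + (pos y μ - M * i.1 μ)| := by ring_nf
        _ ≤ |pos x μ - pos y μ| + |pos y μ - M * i.1 μ| := abs_add_le _ _
        _ < 1 / 8 * M + 5 / 8 * M := add_lt_add_of_le_of_lt (hxy μ) (hCube_ne_zero_imp hM hiy μ)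
        _ = 3 / 4 * M := by ring
  have hgoodS₀ : ∀ i ∈ S₀, good i.1 := fun i hi =>
    hR₀ i.1 i.2 (Finset.mem_filter.mp hi).2 i.1 i.2 fun μ => by simp
  have hR₀' : ∀ i ∈ S₀, ∀ j : ↥s, (∀ μ, |i.1 μ - j.1 μ| ≤ (n₀ : ℤ)) → good j.1 :=
    fun i hi j hij => hR₀ i.1 i.2 (Finset.mem_filter.mp hi).2 j.1 j.2 hij
  -- the first-letter input `‖P_b·h_jG_jh_j‖ ≤ γ′ + wγ` for both families at the starting cubes
  have hnPa_gen : ∀ (Gx : (Fin d → ℤ) → Matrix (X × κ) (X × κ) ℝ),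
      (∀ i : ↥s, good i.1 → ‖Gx i.1‖ ≤ γ) → (∀ i : ↥s, good i.1 → ‖Pb * Gx i.1‖ ≤ γ') →
      ∀ i ∈ S₀, ‖Pb * (mulH (ι := κ) (h i.1) * Gx i.1 * mulH (ι := κ) (h i.1))‖ ≤ γ' + w * γ := by
    intro Gx hGx hGx' j hj
    have hsplit : Pb * (mulH (ι := κ) (h j.1) * Gx j.1 * mulH (ι := κ) (h j.1))
        = h j.1 x • (Pb * Gx j.1 * mulH (ι := κ) (h j.1))
          + (h j.1 y - h j.1 x) • (unitOp x y (W x y) * Gx j.1 * mulH (ι := κ) (h j.1)) := by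
      rw [← Matrix.mul_assoc, ← Matrix.mul_assoc, hPbH j.1, Matrix.add_mul, Matrix.add_mul, Matrix.smul_mul,
        Matrix.smul_mul, Matrix.smul_mul, Matrix.smul_mul]
    have hdiff : |h j.1 y - h j.1 x| ≤ 1 := by
      rw [abs_le]; constructor <;> linarith [hh0 j.1 y, hhle j.1 y, hh0 j.1 x, hhle j.1 x]
    rw [hsplit]
    calc ‖h j.1 x • (Pb * Gx j.1 * mulH (ι := κ) (h j.1))
          + (h j.1 y - h j.1 x) • (unitOp x y (W x y) * Gx j.1 * mulH (ι := κ) (h j.1))‖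
        ≤ ‖h j.1 x • (Pb * Gx j.1 * mulH (ι := κ) (h j.1))‖
          + ‖(h j.1 y - h j.1 x) • (unitOp x y (W x y) * Gx j.1 * mulH (ι := κ) (h j.1))‖ := norm_add_le _ _
      _ ≤ 1 * (γ' * 1) + 1 * ((w * γ) * 1) := by
          rw [norm_smul, norm_smul, Real.norm_eq_abs, Real.norm_eq_abs]
          refine add_le_add (mul_le_mul (hh1 j.1 x) ?_ (norm_nonneg _) zero_le_one)
            (mul_le_mul hdiff ?_ (norm_nonneg _) zero_le_one)
          · exact (norm_mul_le _ _).trans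
              (mul_le_mul (hGx' j (hgoodS₀ j hj)) (hnH j.1) (norm_nonneg _) hγ'0)
          · exact (norm_mul_le _ _).trans (mul_le_mul ((norm_mul_le _ _).trans
              (mul_le_mul hnUW (hGx j (hgoodS₀ j hj)) (norm_nonneg _) hw0)) (hnH j.1) (norm_nonneg _)
              (mul_nonneg hw0 hγ0))
      _ = γ' + w * γ := by ring
  have hmain := probe_delta_bound_lp hM pos c m2 a q W T hc hq s hs S hS hS1 hSq W' T' hWW' hTT' Ω Gj hGj GjΩ hGjΩ
    G hGH G' hG'H Pb S₀ hcard hP0 x (ρ := 3 / 4) hS₀ρ good hn₀ hω (by positivity : 0 ≤ γ' + w * γ) hβ0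
    (hnPa_gen Gj hγ hγ') (hnPa_gen GjΩ hγΩ hγ'Ω) h0 h0Ω hgr hgrΩ h2 h2Ω h3β hR₀' F hD hD₀ hD₁ f hfF hV hfV
  calc ‖Pb *ᵥ ((G - G') *ᵥ f)‖
      ≤ 4 * ((2 ^ (d + 1) : ℕ) : ℝ) * (γ' + w * γ) * V * Real.exp (3 / 4 + 29 / 8)
          * Real.exp (-((D + D₀ + D₁) / (2 * M))) * ‖f‖ := hmain
    _ = 2 ^ (d + 3) * Real.exp (35 / 8) * (γ' + w * γ) * V * Real.exp (-((D + D₀ + D₁) / (2 * M))) * ‖f‖ := by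
        push_cast
        rw [show (3 / 4 + 29 / 8 : ℝ) = 35 / 8 by norm_num]
        ring

/-- **(1.11)–(1.12) AS PRINTED, derivative member, general `Ω ⊂ Ω₀` under the `R₀` condition**: for `f` supported in
`F × κ` with `‖f‖₂ ≤ V‖f‖_∞` and every colour `k`:
`|(W(x,y)(δG_kf)(y) − (δG_kf)(x))_k| ≤ 2^{d+3}e^{35/8}(γ′ + wγ)V·exp(−(D + D₀ + D₁)/(2M))·‖f‖_∞`.
[cite: Balaban1983RegularityDecay, Theorem (1.10)–(1.12) p.573, (1.3) p.572] -/
theorem ineq112_deriv_lp_apply {M : ℝ} (hM : 0 < M) (pos : X → Fin d → ℝ) (c : X → X → ℝ) (m2 a : ℝ)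
    (q : Y → X → ℝ) (W : X → X → Matrix κ κ ℝ) (T : Y → X → Matrix κ κ ℝ)
    (hc : ∀ x z', c x z' ≠ 0 → ∀ μ, |pos x μ - pos z' μ| ≤ 1 / 8 * M)
    (hq : ∀ y x z', q y x ≠ 0 → q y z' ≠ 0 → ∀ μ, |pos x μ - pos z' μ| ≤ 1 / 8 * M)
    (s : Finset (Fin d → ℤ)) (hs : ∀ j x, hCube M j (pos x) ≠ 0 → j ∈ s)
    (S : (Fin d → ℤ) → X → Prop) [∀ j, DecidablePred (S j)]
    (hS : ∀ j z, (∀ μ, |pos z μ - M * j μ| ≤ 7 / 8 * M) → S j z)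
    (hS1 : ∀ j z, S j z → ∀ μ, |pos z μ - M * j μ| ≤ M)
    (hSq : ∀ j y z z', q y z ≠ 0 → q y z' ≠ 0 → (S j z ↔ S j z'))
    (W' : (Fin d → ℤ) → X → X → Matrix κ κ ℝ) (T' : (Fin d → ℤ) → Y → X → Matrix κ κ ℝ)
    (hWW' : ∀ j x z', (∀ μ, |pos x μ - M * j μ| ≤ 3 / 4 * M) → (∀ μ, |pos z' μ - M * j μ| ≤ 3 / 4 * M) →
      W' j x z' = W x z')
    (hTT' : ∀ j y x, q y x ≠ 0 → (∀ μ, |pos x μ - M * j μ| ≤ 3 / 4 * M) → T' j y x = T y x)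
    (Ω : X → Prop) [DecidablePred Ω]
    (Gj : (Fin d → ℤ) → Matrix (X × κ) (X × κ) ℝ)
    (hGj : ∀ j ∈ s, covOp (fun z z' => if (S j z ↔ S j z') then c z z' else 0) m2 a q (W' j) (T' j) * Gj j = 1)
    (GjΩ : (Fin d → ℤ) → Matrix (X × κ) (X × κ) ℝ)
    (hGjΩ : ∀ j ∈ s, covOp (fun z z' => if (S j z ↔ S j z') then (if (Ω z ↔ Ω z') then c z z' else 0) else 0)
      m2 a q (W' j) (T' j) * GjΩ j = 1)
    (G : Matrix (X × κ) (X × κ) ℝ) (hGH : G * covOp (fun z z' => if (Ω z ↔ Ω z') then c z z' else 0) m2 a q W T = 1)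
    (G' : Matrix (X × κ) (X × κ) ℝ) (hG'H : G' * covOp c m2 a q W T = 1)
    (x y : X) (hxy : ∀ μ, |pos x μ - pos y μ| ≤ 1 / 8 * M) {w : ℝ} (hw0 : 0 ≤ w)
    (hw : ∀ k, ∑ k', |W x y k k'| ≤ w)
    (good : (Fin d → ℤ) → Prop) {γ γ' β ω : ℝ} {n₀ : ℕ} (hn₀ : 0 < n₀) (hω : 0 < ω) (hγ0 : 0 ≤ γ) (hγ'0 : 0 ≤ γ')
    (hβ0 : 0 ≤ β) (hγ : ∀ i : ↥s, good i.1 → ‖Gj i.1‖ ≤ γ) (hγΩ : ∀ i : ↥s, good i.1 → ‖GjΩ i.1‖ ≤ γ)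
    (hγ' : ∀ i : ↥s, good i.1 → ‖(unitOp x y (W x y) - unitOp x x 1) * Gj i.1‖ ≤ γ')
    (hγ'Ω : ∀ i : ↥s, good i.1 → ‖(unitOp x y (W x y) - unitOp x x 1) * GjΩ i.1‖ ≤ γ')
    (h0 : ∀ i : ↥s, good i.1 → ‖opK (fun z z' => if (S i.1 z ↔ S i.1 z') then c z z' else 0) m2 a q (W' i.1) (T' i.1)
        (fun z => hCube M i.1 (pos z)) * Gj i.1 * mulH (ι := κ) (fun z => hCube M i.1 (pos z))‖ ≤ β)
    (h0Ω : ∀ i : ↥s, good i.1 → ‖opK (fun z z' => if (S i.1 z ↔ S i.1 z') then (if (Ω z ↔ Ω z') then c z z' else 0) else 0)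
        m2 a q (W' i.1) (T' i.1) (fun z => hCube M i.1 (pos z)) * GjΩ i.1
        * mulH (ι := κ) (fun z => hCube M i.1 (pos z))‖ ≤ β)
    (hgr : ∀ i : ↥s, good i.1 → ∀ t : ℕ, 1 ≤ t → t ≤ n₀ → ∀ g : X × κ → ℝ,
      lvl ω n₀ (t - 1) ((opK (fun z z' => if (S i.1 z ↔ S i.1 z') then c z z' else 0) m2 a q (W' i.1) (T' i.1)
        (fun z => hCube M i.1 (pos z)) * Gj i.1 * mulH (ι := κ) (fun z => hCube M i.1 (pos z))) *ᵥ g) ≤ β * lvl ω n₀ t g)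
    (hgrΩ : ∀ i : ↥s, good i.1 → ∀ t : ℕ, 1 ≤ t → t ≤ n₀ → ∀ g : X × κ → ℝ,
      lvl ω n₀ (t - 1) ((opK (fun z z' => if (S i.1 z ↔ S i.1 z') then (if (Ω z ↔ Ω z') then c z z' else 0) else 0)
        m2 a q (W' i.1) (T' i.1) (fun z => hCube M i.1 (pos z)) * GjΩ i.1
        * mulH (ι := κ) (fun z => hCube M i.1 (pos z))) *ᵥ g) ≤ β * lvl ω n₀ t g)
    (h2 : ∀ (i : ↥s) (g : X × κ → ℝ), lpv ω 2 ((opK (fun z z' => if (S i.1 z ↔ S i.1 z') then c z z' else 0) m2 a q (W' i.1) (T' i.1)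
        (fun z => hCube M i.1 (pos z)) * Gj i.1 * mulH (ι := κ) (fun z => hCube M i.1 (pos z))) *ᵥ g) ≤ β * lpv ω 2 g)
    (h2Ω : ∀ (i : ↥s) (g : X × κ → ℝ), lpv ω 2 ((opK (fun z z' => if (S i.1 z ↔ S i.1 z') then (if (Ω z ↔ Ω z') then c z z' else 0) else 0)
        m2 a q (W' i.1) (T' i.1) (fun z => hCube M i.1 (pos z)) * GjΩ i.1
        * mulH (ι := κ) (fun z => hCube M i.1 (pos z))) *ᵥ g) ≤ β * lpv ω 2 g)
    (h3β : (3 : ℝ) ^ d * β ≤ Real.exp (-1))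
    (hR₀ : ∀ i ∈ s, (hCube M i (pos x) ≠ 0 ∨ hCube M i (pos y) ≠ 0) →
      ∀ j ∈ s, (∀ μ, |i μ - j μ| ≤ (n₀ : ℤ)) → good j)
    (F : X → Prop) [DecidablePred F] {D D₀ D₁ : ℝ}
    (hD : ∀ x'', F x'' → ∃ μ, D ≤ |pos x μ - pos x'' μ|)
    (hD₀ : ∀ x₁, ¬ Ω x₁ → ∃ μ, D₀ ≤ |pos x μ - pos x₁ μ|)
    (hD₁ : ∀ x'', F x'' → ∀ x₁, ¬ Ω x₁ → ∃ μ, D₁ ≤ |pos x₁ μ - pos x'' μ|)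
    (f : X × κ → ℝ) (hfF : ∀ p : X × κ, ¬ F p.1 → f p = 0) {V : ℝ} (hV : 1 ≤ V) (hfV : lpv ω 2 f ≤ V * ‖f‖) (k : κ) :
    |(W x y *ᵥ fld ((G - G') *ᵥ f) y - fld ((G - G') *ᵥ f) x) k|
      ≤ 2 ^ (d + 3) * Real.exp (35 / 8) * (γ' + w * γ) * V * Real.exp (-((D + D₀ + D₁) / (2 * M))) * ‖f‖ := by
  have hmain := ineq112_deriv_lp hM pos c m2 a q W T hc hq s hs S hS hS1 hSq W' T' hWW' hTT' Ω Gj hGj GjΩ hGjΩ G hGH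
    G' hG'H x y hxy hw0 hw good hn₀ hω hγ0 hγ'0 hβ0 hγ hγΩ hγ' hγ'Ω h0 h0Ω hgr hgrΩ h2 h2Ω h3β hR₀ F hD hD₀ hD₁ f hfF
    hV hfV
  have hentry : ((unitOp x y (W x y) - unitOp x x 1) *ᵥ ((G - G') *ᵥ f)) (x, k)
      = (W x y *ᵥ fld ((G - G') *ᵥ f) y - fld ((G - G') *ᵥ f) x) k := by
    rw [← fld_apply ((unitOp x y (W x y) - unitOp x x 1) *ᵥ ((G - G') *ᵥ f)) x k, fld_bondOp_mulVec]
  rw [← hentry, ← Real.norm_eq_abs]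
  exact (norm_le_pi_norm _ (x, k)).trans hmain

/-- **[B4] THEOREM (1.11)–(1.12), HÖLDER MEMBER, GENERAL PAIR `Ω ⊂ Ω₀`, UNDER THE `R₀` CONDITION — by the mixed `L^p`
chain.**  Instance of `B4Ineq112LpChain.probe_delta_bound_lp` with the Hölder probe
`P_H = σ·(E_{xy′}[UW(x′,y′)] − E_{xx′}[U] − (E_{xy}[W(x,y)] − E_{xx}[1]))` (pair `x, x′`, bonds `b = ⟨x,y⟩`, `b′ = ⟨x′,y′⟩`
within `M/8`; any `σ` ↦ `|x−x′|^{−α}`, any `U` ↦ `U(A(Γ_{x,x′}))`): `≤ 2^{d+2}` cubes see one of `x, y, x′, y′`, all within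
`(7/8)M` of `x`; Hölder inputs `‖P_H·h_jG_jh_j‖, ‖P_H·h_jG_j^Ωh_j‖ ≤ γ_H` at the good cubes.  Conclusion:
`‖P_H((G_k(Ω,A) − G_k(Ω₀,A))f)‖_∞ ≤ 2^{d+4}e^{9/2}γ_H·V·exp(−(D + D₀ + D₁)/(2M))·‖f‖_∞`.
[cite: Balaban1983RegularityDecay, Theorem (1.9), (1.11)–(1.12) p.573; (2.14) p.577; p.579 after (2.22); Cor. 2.3 p.581] -/
theorem ineq112_holder_lp {M : ℝ} (hM : 0 < M) (pos : X → Fin d → ℝ) (c : X → X → ℝ) (m2 a : ℝ)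
    (q : Y → X → ℝ) (W : X → X → Matrix κ κ ℝ) (T : Y → X → Matrix κ κ ℝ)
    (hc : ∀ x z', c x z' ≠ 0 → ∀ μ, |pos x μ - pos z' μ| ≤ 1 / 8 * M)
    (hq : ∀ y x z', q y x ≠ 0 → q y z' ≠ 0 → ∀ μ, |pos x μ - pos z' μ| ≤ 1 / 8 * M)
    (s : Finset (Fin d → ℤ)) (hs : ∀ j x, hCube M j (pos x) ≠ 0 → j ∈ s)
    (S : (Fin d → ℤ) → X → Prop) [∀ j, DecidablePred (S j)]
    (hS : ∀ j z, (∀ μ, |pos z μ - M * j μ| ≤ 7 / 8 * M) → S j z)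
    (hS1 : ∀ j z, S j z → ∀ μ, |pos z μ - M * j μ| ≤ M)
    (hSq : ∀ j y z z', q y z ≠ 0 → q y z' ≠ 0 → (S j z ↔ S j z'))
    (W' : (Fin d → ℤ) → X → X → Matrix κ κ ℝ) (T' : (Fin d → ℤ) → Y → X → Matrix κ κ ℝ)
    (hWW' : ∀ j x z', (∀ μ, |pos x μ - M * j μ| ≤ 3 / 4 * M) → (∀ μ, |pos z' μ - M * j μ| ≤ 3 / 4 * M) →
      W' j x z' = W x z')
    (hTT' : ∀ j y x, q y x ≠ 0 → (∀ μ, |pos x μ - M * j μ| ≤ 3 / 4 * M) → T' j y x = T y x)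
    (Ω : X → Prop) [DecidablePred Ω]
    (Gj : (Fin d → ℤ) → Matrix (X × κ) (X × κ) ℝ)
    (hGj : ∀ j ∈ s, covOp (fun z z' => if (S j z ↔ S j z') then c z z' else 0) m2 a q (W' j) (T' j) * Gj j = 1)
    (GjΩ : (Fin d → ℤ) → Matrix (X × κ) (X × κ) ℝ)
    (hGjΩ : ∀ j ∈ s, covOp (fun z z' => if (S j z ↔ S j z') then (if (Ω z ↔ Ω z') then c z z' else 0) else 0)
      m2 a q (W' j) (T' j) * GjΩ j = 1)
    (G : Matrix (X × κ) (X × κ) ℝ) (hGH : G * covOp (fun z z' => if (Ω z ↔ Ω z') then c z z' else 0) m2 a q W T = 1)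
    (G' : Matrix (X × κ) (X × κ) ℝ) (hG'H : G' * covOp c m2 a q W T = 1)
    -- the pair of points, the two bonds, the Hölder weight and the transport
    (x y x' y' : X) (hxy : ∀ μ, |pos x μ - pos y μ| ≤ 1 / 8 * M) (hxx' : ∀ μ, |pos x μ - pos x' μ| ≤ 1 / 8 * M)
    (hx'y' : ∀ μ, |pos x' μ - pos y' μ| ≤ 1 / 8 * M) (σ : ℝ) (U : Matrix κ κ ℝ)
    -- the interior cubes and the per-cube analytic inputs for both families, in the printed norms
    (good : (Fin d → ℤ) → Prop) {γH β ω : ℝ} {n₀ : ℕ} (hn₀ : 0 < n₀) (hω : 0 < ω) (hγH0 : 0 ≤ γH) (hβ0 : 0 ≤ β)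
    (hγH : ∀ i : ↥s, good i.1 → ‖σ • (unitOp x y' (U * W x' y') - unitOp x x' U - (unitOp x y (W x y) - unitOp x x 1))
        * (mulH (ι := κ) (fun z => hCube M i.1 (pos z)) * Gj i.1
        * mulH (ι := κ) (fun z => hCube M i.1 (pos z)))‖ ≤ γH)
    (hγHΩ : ∀ i : ↥s, good i.1 → ‖σ • (unitOp x y' (U * W x' y') - unitOp x x' U - (unitOp x y (W x y) - unitOp x x 1))
        * (mulH (ι := κ) (fun z => hCube M i.1 (pos z)) * GjΩ i.1
        * mulH (ι := κ) (fun z => hCube M i.1 (pos z)))‖ ≤ γH)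
    (h0 : ∀ i : ↥s, good i.1 → ‖opK (fun z z' => if (S i.1 z ↔ S i.1 z') then c z z' else 0) m2 a q (W' i.1) (T' i.1)
        (fun z => hCube M i.1 (pos z)) * Gj i.1 * mulH (ι := κ) (fun z => hCube M i.1 (pos z))‖ ≤ β)
    (h0Ω : ∀ i : ↥s, good i.1 → ‖opK (fun z z' => if (S i.1 z ↔ S i.1 z') then (if (Ω z ↔ Ω z') then c z z' else 0) else 0)
        m2 a q (W' i.1) (T' i.1) (fun z => hCube M i.1 (pos z)) * GjΩ i.1
        * mulH (ι := κ) (fun z => hCube M i.1 (pos z))‖ ≤ β)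
    (hgr : ∀ i : ↥s, good i.1 → ∀ t : ℕ, 1 ≤ t → t ≤ n₀ → ∀ g : X × κ → ℝ,
      lvl ω n₀ (t - 1) ((opK (fun z z' => if (S i.1 z ↔ S i.1 z') then c z z' else 0) m2 a q (W' i.1) (T' i.1)
        (fun z => hCube M i.1 (pos z)) * Gj i.1 * mulH (ι := κ) (fun z => hCube M i.1 (pos z))) *ᵥ g) ≤ β * lvl ω n₀ t g)
    (hgrΩ : ∀ i : ↥s, good i.1 → ∀ t : ℕ, 1 ≤ t → t ≤ n₀ → ∀ g : X × κ → ℝ,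
      lvl ω n₀ (t - 1) ((opK (fun z z' => if (S i.1 z ↔ S i.1 z') then (if (Ω z ↔ Ω z') then c z z' else 0) else 0)
        m2 a q (W' i.1) (T' i.1) (fun z => hCube M i.1 (pos z)) * GjΩ i.1
        * mulH (ι := κ) (fun z => hCube M i.1 (pos z))) *ᵥ g) ≤ β * lvl ω n₀ t g)
    (h2 : ∀ (i : ↥s) (g : X × κ → ℝ), lpv ω 2 ((opK (fun z z' => if (S i.1 z ↔ S i.1 z') then c z z' else 0) m2 a q (W' i.1) (T' i.1)
        (fun z => hCube M i.1 (pos z)) * Gj i.1 * mulH (ι := κ) (fun z => hCube M i.1 (pos z))) *ᵥ g) ≤ β * lpv ω 2 g)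
    (h2Ω : ∀ (i : ↥s) (g : X × κ → ℝ), lpv ω 2 ((opK (fun z z' => if (S i.1 z ↔ S i.1 z') then (if (Ω z ↔ Ω z') then c z z' else 0) else 0)
        m2 a q (W' i.1) (T' i.1) (fun z => hCube M i.1 (pos z)) * GjΩ i.1
        * mulH (ι := κ) (fun z => hCube M i.1 (pos z))) *ᵥ g) ≤ β * lpv ω 2 g)
    (h3β : (3 : ℝ) ^ d * β ≤ Real.exp (-1))
    (hR₀ : ∀ i ∈ s, (hCube M i (pos x) ≠ 0 ∨ hCube M i (pos y) ≠ 0 ∨ hCube M i (pos x') ≠ 0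
      ∨ hCube M i (pos y') ≠ 0) → ∀ j ∈ s, (∀ μ, |i μ - j μ| ≤ (n₀ : ℤ)) → good j)
    -- the support set, the three separations, the function
    (F : X → Prop) [DecidablePred F] {D D₀ D₁ : ℝ}
    (hD : ∀ x'', F x'' → ∃ μ, D ≤ |pos x μ - pos x'' μ|)
    (hD₀ : ∀ x₁, ¬ Ω x₁ → ∃ μ, D₀ ≤ |pos x μ - pos x₁ μ|)
    (hD₁ : ∀ x'', F x'' → ∀ x₁, ¬ Ω x₁ → ∃ μ, D₁ ≤ |pos x₁ μ - pos x'' μ|)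
    (f : X × κ → ℝ) (hfF : ∀ p : X × κ, ¬ F p.1 → f p = 0) {V : ℝ} (hV : 1 ≤ V) (hfV : lpv ω 2 f ≤ V * ‖f‖) :
    ‖(σ • (unitOp x y' (U * W x' y') - unitOp x x' U - (unitOp x y (W x y) - unitOp x x 1))) *ᵥ ((G - G') *ᵥ f)‖
      ≤ 2 ^ (d + 4) * Real.exp (9 / 2) * γH * V * Real.exp (-((D + D₀ + D₁) / (2 * M))) * ‖f‖ := by
  classical
  set h : (Fin d → ℤ) → X → ℝ := fun j z => hCube M j (pos z) with hh
  -- the starting cubes: those seeing one of `x, y, x′, y′`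
  set S₀ : Finset ↥s := Finset.univ.filter fun i : ↥s =>
    h i.1 x ≠ 0 ∨ h i.1 y ≠ 0 ∨ h i.1 x' ≠ 0 ∨ h i.1 y' ≠ 0 with hS₀
  have hcard : S₀.card ≤ 2 ^ (d + 2) := by
    have hsub : S₀.map (Function.Embedding.subtype (· ∈ s))
        ⊆ ((Fintype.piFinset fun μ => ({⌊pos x μ / M⌋, ⌊pos x μ / M⌋ + 1} : Finset ℤ))
          ∪ (Fintype.piFinset fun μ => ({⌊pos y μ / M⌋, ⌊pos y μ / M⌋ + 1} : Finset ℤ)))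
          ∪ ((Fintype.piFinset fun μ => ({⌊pos x' μ / M⌋, ⌊pos x' μ / M⌋ + 1} : Finset ℤ))
          ∪ (Fintype.piFinset fun μ => ({⌊pos y' μ / M⌋, ⌊pos y' μ / M⌋ + 1} : Finset ℤ))) := by
      intro j hj
      obtain ⟨i, hi, rfl⟩ := Finset.mem_map.mp hj
      obtain ⟨-, hi4⟩ := Finset.mem_filter.mp hi
      rcases hi4 with h1 | h2 | h3 | h4
      · exact Finset.mem_union_left _ (Finset.mem_union_left _ (mem_box_of_hCube_ne_zero h1))
      · exact Finset.mem_union_left _ (Finset.mem_union_right _ (mem_box_of_hCube_ne_zero h2))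
      · exact Finset.mem_union_right _ (Finset.mem_union_left _ (mem_box_of_hCube_ne_zero h3))
      · exact Finset.mem_union_right _ (Finset.mem_union_right _ (mem_box_of_hCube_ne_zero h4))
    calc S₀.card = (S₀.map (Function.Embedding.subtype (· ∈ s))).card := (Finset.card_map _).symm
      _ ≤ _ := Finset.card_le_card hsub
      _ ≤ _ := Finset.card_union_le _ _
      _ ≤ (2 ^ d + 2 ^ d) + (2 ^ d + 2 ^ d) :=
          add_le_add ((Finset.card_union_le _ _).trans (add_le_add (card_labelBox_le M (pos x))
            (card_labelBox_le M (pos y)))) ((Finset.card_union_le _ _).trans (add_le_add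
            (card_labelBox_le M (pos x')) (card_labelBox_le M (pos y'))))
      _ = 2 ^ (d + 2) := by ring
  have hP0 : ∀ i : ↥s, i ∉ S₀ → (σ • (unitOp x y' (U * W x' y') - unitOp x x' U - (unitOp x y (W x y) - unitOp x x 1))) * mulH (ι := κ) (h i.1) = 0 := by
    intro i hi
    have hz : ∀ z, (z = x ∨ z = y ∨ z = x' ∨ z = y') → h i.1 z = 0 := by
      intro z hz
      by_contra hne
      apply hi
      refine Finset.mem_filter.mpr ⟨Finset.mem_univ _, ?_⟩
      rcases hz with rfl | rfl | rfl | rfl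
      · exact Or.inl hne
      · exact Or.inr (Or.inl hne)
      · exact Or.inr (Or.inr (Or.inl hne))
      · exact Or.inr (Or.inr (Or.inr hne))
    rw [holderOp_mul_mulH, hz x (Or.inl rfl), hz y (Or.inr (Or.inl rfl)), hz x' (Or.inr (Or.inr (Or.inl rfl))),
      hz y' (Or.inr (Or.inr (Or.inr rfl)))]
    simp
  have hS₀ρ : ∀ i ∈ S₀, ∀ μ, |pos x μ - M * i.1 μ| < 7 / 8 * M := by
    intro i hi μ
    obtain ⟨-, hi4⟩ := Finset.mem_filter.mp hi
    have hnear : ∀ z, (∀ ν, |pos x ν - pos z ν| ≤ 2 / 8 * M) → h i.1 z ≠ 0 →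
        |pos x μ - M * i.1 μ| < 7 / 8 * M := by
      intro z hz hiz
      calc |pos x μ - M * i.1 μ| = |(pos x μ - pos z μ) + (pos z μ - M * i.1 μ)| := by ring_nf
        _ ≤ |pos x μ - pos z μ| + |pos z μ - M * i.1 μ| := abs_add_le _ _
        _ < 2 / 8 * M + 5 / 8 * M := add_lt_add_of_le_of_lt (hz μ) (hCube_ne_zero_imp hM hiz μ)
        _ = 7 / 8 * M := by ring
    rcases hi4 with h1 | h2 | h3 | h4
    · exact hnear x (fun ν => by rw [sub_self, abs_zero]; positivity) h1
    · exact hnear y (fun ν => (hxy ν).trans (by nlinarith)) h2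
    · exact hnear x' (fun ν => (hxx' ν).trans (by nlinarith)) h3
    · refine hnear y' (fun ν => ?_) h4
      calc |pos x ν - pos y' ν| = |(pos x ν - pos x' ν) + (pos x' ν - pos y' ν)| := by ring_nf
        _ ≤ |pos x ν - pos x' ν| + |pos x' ν - pos y' ν| := abs_add_le _ _
        _ ≤ 1 / 8 * M + 1 / 8 * M := add_le_add (hxx' ν) (hx'y' ν)
        _ = 2 / 8 * M := by ring
  have hgoodS₀ : ∀ i ∈ S₀, good i.1 := fun i hi =>
    hR₀ i.1 i.2 (Finset.mem_filter.mp hi).2 i.1 i.2 fun μ => by simp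
  have hR₀' : ∀ i ∈ S₀, ∀ j : ↥s, (∀ μ, |i.1 μ - j.1 μ| ≤ (n₀ : ℤ)) → good j.1 :=
    fun i hi j hij => hR₀ i.1 i.2 (Finset.mem_filter.mp hi).2 j.1 j.2 hij
  have hmain := probe_delta_bound_lp hM pos c m2 a q W T hc hq s hs S hS hS1 hSq W' T' hWW' hTT' Ω Gj hGj GjΩ hGjΩ
    G hGH G' hG'H (σ • (unitOp x y' (U * W x' y') - unitOp x x' U - (unitOp x y (W x y) - unitOp x x 1))) S₀ hcard hP0 x
    (ρ := 7 / 8) hS₀ρ good hn₀ hω hγH0 hβ0 (fun i hi => hγH i (hgoodS₀ i hi)) (fun i hi => hγHΩ i (hgoodS₀ i hi))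
    h0 h0Ω hgr hgrΩ h2 h2Ω h3β hR₀' F hD hD₀ hD₁ f hfF hV hfV
  calc _ ≤ 4 * ((2 ^ (d + 2) : ℕ) : ℝ) * γH * V * Real.exp (7 / 8 + 29 / 8)
          * Real.exp (-((D + D₀ + D₁) / (2 * M))) * ‖f‖ := hmain
    _ = 2 ^ (d + 4) * Real.exp (9 / 2) * γH * V * Real.exp (-((D + D₀ + D₁) / (2 * M))) * ‖f‖ := by
        push_cast
        rw [show (7 / 8 + 29 / 8 : ℝ) = 9 / 2 by norm_num]
        ring

/-- **(1.11)–(1.12) AS PRINTED, Hölder member, general `Ω ⊂ Ω₀` under the `R₀` condition**: for `f` supported in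
`F × κ` with `‖f‖₂ ≤ V‖f‖_∞` and every colour `k`, the transported Hölder difference of the covariant bond differences
of `δG_k(Ω,Ω₀,A)f` obeys `|σ·(U(W(x′,y′)(δGf)(y′) − (δGf)(x′)) − (W(x,y)(δGf)(y) − (δGf)(x)))_k|
≤ 2^{d+4}e^{9/2}γ_HV·exp(−(D + D₀ + D₁)/(2M))·‖f‖_∞`. [cite: Balaban1983RegularityDecay, Theorem (1.9), (1.11)–(1.12) p.573] -/
theorem ineq112_holder_lp_apply {M : ℝ} (hM : 0 < M) (pos : X → Fin d → ℝ) (c : X → X → ℝ) (m2 a : ℝ)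
    (q : Y → X → ℝ) (W : X → X → Matrix κ κ ℝ) (T : Y → X → Matrix κ κ ℝ)
    (hc : ∀ x z', c x z' ≠ 0 → ∀ μ, |pos x μ - pos z' μ| ≤ 1 / 8 * M)
    (hq : ∀ y x z', q y x ≠ 0 → q y z' ≠ 0 → ∀ μ, |pos x μ - pos z' μ| ≤ 1 / 8 * M)
    (s : Finset (Fin d → ℤ)) (hs : ∀ j x, hCube M j (pos x) ≠ 0 → j ∈ s)
    (S : (Fin d → ℤ) → X → Prop) [∀ j, DecidablePred (S j)]
    (hS : ∀ j z, (∀ μ, |pos z μ - M * j μ| ≤ 7 / 8 * M) → S j z)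
    (hS1 : ∀ j z, S j z → ∀ μ, |pos z μ - M * j μ| ≤ M)
    (hSq : ∀ j y z z', q y z ≠ 0 → q y z' ≠ 0 → (S j z ↔ S j z'))
    (W' : (Fin d → ℤ) → X → X → Matrix κ κ ℝ) (T' : (Fin d → ℤ) → Y → X → Matrix κ κ ℝ)
    (hWW' : ∀ j x z', (∀ μ, |pos x μ - M * j μ| ≤ 3 / 4 * M) → (∀ μ, |pos z' μ - M * j μ| ≤ 3 / 4 * M) →
      W' j x z' = W x z')
    (hTT' : ∀ j y x, q y x ≠ 0 → (∀ μ, |pos x μ - M * j μ| ≤ 3 / 4 * M) → T' j y x = T y x)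
    (Ω : X → Prop) [DecidablePred Ω]
    (Gj : (Fin d → ℤ) → Matrix (X × κ) (X × κ) ℝ)
    (hGj : ∀ j ∈ s, covOp (fun z z' => if (S j z ↔ S j z') then c z z' else 0) m2 a q (W' j) (T' j) * Gj j = 1)
    (GjΩ : (Fin d → ℤ) → Matrix (X × κ) (X × κ) ℝ)
    (hGjΩ : ∀ j ∈ s, covOp (fun z z' => if (S j z ↔ S j z') then (if (Ω z ↔ Ω z') then c z z' else 0) else 0)
      m2 a q (W' j) (T' j) * GjΩ j = 1)
    (G : Matrix (X × κ) (X × κ) ℝ) (hGH : G * covOp (fun z z' => if (Ω z ↔ Ω z') then c z z' else 0) m2 a q W T = 1)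
    (G' : Matrix (X × κ) (X × κ) ℝ) (hG'H : G' * covOp c m2 a q W T = 1)
    (x y x' y' : X) (hxy : ∀ μ, |pos x μ - pos y μ| ≤ 1 / 8 * M) (hxx' : ∀ μ, |pos x μ - pos x' μ| ≤ 1 / 8 * M)
    (hx'y' : ∀ μ, |pos x' μ - pos y' μ| ≤ 1 / 8 * M) (σ : ℝ) (U : Matrix κ κ ℝ)
    (good : (Fin d → ℤ) → Prop) {γH β ω : ℝ} {n₀ : ℕ} (hn₀ : 0 < n₀) (hω : 0 < ω) (hγH0 : 0 ≤ γH) (hβ0 : 0 ≤ β)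
    (hγH : ∀ i : ↥s, good i.1 → ‖σ • (unitOp x y' (U * W x' y') - unitOp x x' U - (unitOp x y (W x y) - unitOp x x 1))
        * (mulH (ι := κ) (fun z => hCube M i.1 (pos z)) * Gj i.1
        * mulH (ι := κ) (fun z => hCube M i.1 (pos z)))‖ ≤ γH)
    (hγHΩ : ∀ i : ↥s, good i.1 → ‖σ • (unitOp x y' (U * W x' y') - unitOp x x' U - (unitOp x y (W x y) - unitOp x x 1))
        * (mulH (ι := κ) (fun z => hCube M i.1 (pos z)) * GjΩ i.1
        * mulH (ι := κ) (fun z => hCube M i.1 (pos z)))‖ ≤ γH)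
    (h0 : ∀ i : ↥s, good i.1 → ‖opK (fun z z' => if (S i.1 z ↔ S i.1 z') then c z z' else 0) m2 a q (W' i.1) (T' i.1)
        (fun z => hCube M i.1 (pos z)) * Gj i.1 * mulH (ι := κ) (fun z => hCube M i.1 (pos z))‖ ≤ β)
    (h0Ω : ∀ i : ↥s, good i.1 → ‖opK (fun z z' => if (S i.1 z ↔ S i.1 z') then (if (Ω z ↔ Ω z') then c z z' else 0) else 0)
        m2 a q (W' i.1) (T' i.1) (fun z => hCube M i.1 (pos z)) * GjΩ i.1
        * mulH (ι := κ) (fun z => hCube M i.1 (pos z))‖ ≤ β)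
    (hgr : ∀ i : ↥s, good i.1 → ∀ t : ℕ, 1 ≤ t → t ≤ n₀ → ∀ g : X × κ → ℝ,
      lvl ω n₀ (t - 1) ((opK (fun z z' => if (S i.1 z ↔ S i.1 z') then c z z' else 0) m2 a q (W' i.1) (T' i.1)
        (fun z => hCube M i.1 (pos z)) * Gj i.1 * mulH (ι := κ) (fun z => hCube M i.1 (pos z))) *ᵥ g) ≤ β * lvl ω n₀ t g)
    (hgrΩ : ∀ i : ↥s, good i.1 → ∀ t : ℕ, 1 ≤ t → t ≤ n₀ → ∀ g : X × κ → ℝ,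
      lvl ω n₀ (t - 1) ((opK (fun z z' => if (S i.1 z ↔ S i.1 z') then (if (Ω z ↔ Ω z') then c z z' else 0) else 0)
        m2 a q (W' i.1) (T' i.1) (fun z => hCube M i.1 (pos z)) * GjΩ i.1
        * mulH (ι := κ) (fun z => hCube M i.1 (pos z))) *ᵥ g) ≤ β * lvl ω n₀ t g)
    (h2 : ∀ (i : ↥s) (g : X × κ → ℝ), lpv ω 2 ((opK (fun z z' => if (S i.1 z ↔ S i.1 z') then c z z' else 0) m2 a q (W' i.1) (T' i.1)
        (fun z => hCube M i.1 (pos z)) * Gj i.1 * mulH (ι := κ) (fun z => hCube M i.1 (pos z))) *ᵥ g) ≤ β * lpv ω 2 g)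
    (h2Ω : ∀ (i : ↥s) (g : X × κ → ℝ), lpv ω 2 ((opK (fun z z' => if (S i.1 z ↔ S i.1 z') then (if (Ω z ↔ Ω z') then c z z' else 0) else 0)
        m2 a q (W' i.1) (T' i.1) (fun z => hCube M i.1 (pos z)) * GjΩ i.1
        * mulH (ι := κ) (fun z => hCube M i.1 (pos z))) *ᵥ g) ≤ β * lpv ω 2 g)
    (h3β : (3 : ℝ) ^ d * β ≤ Real.exp (-1))
    (hR₀ : ∀ i ∈ s, (hCube M i (pos x) ≠ 0 ∨ hCube M i (pos y) ≠ 0 ∨ hCube M i (pos x') ≠ 0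
      ∨ hCube M i (pos y') ≠ 0) → ∀ j ∈ s, (∀ μ, |i μ - j μ| ≤ (n₀ : ℤ)) → good j)
    (F : X → Prop) [DecidablePred F] {D D₀ D₁ : ℝ}
    (hD : ∀ x'', F x'' → ∃ μ, D ≤ |pos x μ - pos x'' μ|)
    (hD₀ : ∀ x₁, ¬ Ω x₁ → ∃ μ, D₀ ≤ |pos x μ - pos x₁ μ|)
    (hD₁ : ∀ x'', F x'' → ∀ x₁, ¬ Ω x₁ → ∃ μ, D₁ ≤ |pos x₁ μ - pos x'' μ|)
    (f : X × κ → ℝ) (hfF : ∀ p : X × κ, ¬ F p.1 → f p = 0) {V : ℝ} (hV : 1 ≤ V) (hfV : lpv ω 2 f ≤ V * ‖f‖) (k : κ) :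
    |(σ • (U *ᵥ (W x' y' *ᵥ fld ((G - G') *ᵥ f) y' - fld ((G - G') *ᵥ f) x')
        - (W x y *ᵥ fld ((G - G') *ᵥ f) y - fld ((G - G') *ᵥ f) x))) k|
      ≤ 2 ^ (d + 4) * Real.exp (9 / 2) * γH * V * Real.exp (-((D + D₀ + D₁) / (2 * M))) * ‖f‖ := by
  have hmain := ineq112_holder_lp hM pos c m2 a q W T hc hq s hs S hS hS1 hSq W' T' hWW' hTT' Ω Gj hGj GjΩ hGjΩ G hGH
    G' hG'H x y x' y' hxy hxx' hx'y' σ U good hn₀ hω hγH0 hβ0 hγH hγHΩ h0 h0Ω hgr hgrΩ h2 h2Ω h3β hR₀ F hD hD₀ hD₁ f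
    hfF hV hfV
  have hentry : ((σ • (unitOp x y' (U * W x' y') - unitOp x x' U - (unitOp x y (W x y) - unitOp x x 1))) *ᵥ ((G - G') *ᵥ f)) (x, k)
      = (σ • (U *ᵥ (W x' y' *ᵥ fld ((G - G') *ᵥ f) y' - fld ((G - G') *ᵥ f) x')
        - (W x y *ᵥ fld ((G - G') *ᵥ f) y - fld ((G - G') *ᵥ f) x))) k := by
    rw [← fld_apply ((σ • (unitOp x y' (U * W x' y') - unitOp x x' U - (unitOp x y (W x y) - unitOp x x 1))) *ᵥ ((G - G') *ᵥ f)) x k, fld_holderOp_mulVec]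
  rw [← hentry, ← Real.norm_eq_abs]
  exact (norm_le_pi_norm _ (x, k)).trans hmain

end Route

end Literature.MathematicalPhysics.QuantumFieldTheory.Balaban1983to89.B4Ineq112LpChainMembers
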